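import Summits.AtomisticToContinuum.HydrodynamicLimit.Theses.OneFlightGossipEngine
import Summits.AtomisticToContinuum.HydrodynamicLimit.Theorems.OneFlightGossipEngineClampedCurrentsDockHiSplitW
import Summits.AtomisticToContinuum.HydrodynamicLimit.Theorems.ImplosionDichotomyHydroLimitInBandWindowContinuityKinematics
import Literature.MathematicalPhysics.KineticTheory.HardSphereDisplacementPathLength
import Literature.Analysis.FluidPDE.CollisionalTransfer
import Literature.MathematicalPhysics.KineticTheory.HardSphereEulerProofs
import HarnessLib

/-!
# The cubic channel, pathwise (stub `stub_cubicChannelPathwise`, QC-a)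

Crux `Summit.AtomisticToContinuum.HydrodynamicLimit.Theses.OneFlightGossipEngine.ClampedCurrentsDock`
(stmt-AtomisticToContinuum-14680), line `IdeatorTwoSketch`, registered stub QC-a
`stub_cubicChannelPathwise : CubicChannelPathwise` (the def re-declared verbatim from the line skeleton, v31;
finding CUTOFF-MATCHING of lead c2, `Cruxes/ClampedCurrentsDock/CUTOFF-MATCHING.md` §"The repair").

Pathwise bookkeeping on ONE window `[0, w]` of the orbit of a good point `z` of the hard-sphere flow on `𝕋³`.
With the peculiar velocity `W_i(r) = v_i(r) − u₀(x_i(r))`, the radial remainder `R(x, s′) = s′ − 5θ₀(x) − G(x, s′)`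
(zero for `s′ ≤ K⋆²` by the agreement clause of the cut-off `G`, and `|R(x, s′)| ≤ C_R s′` above,
`C_R = 1 + (5θM + C_G)/K⋆²`), the suprathermal heat-flux remainder `hi(x, v) = (b(x)·W) R(x, ‖W‖²)` and the signals
`Q_i(r) = R(x_i(r), ‖W_i(r)‖²) • W_i(r)`:

`|∫₀ʷ Σ_i hi(Φ_r z i) dr| ≤ Bb[η Σ_i ∫‖W_i‖³ + C_R Σ_{i coherent} ∫ 1{K⋆ < ‖W_i‖}‖W_i‖³]
  + C_R Σ_i min(2Bb, Lb ∫₀ʷ ‖v_i‖) ∫₀ʷ ‖W_i‖³`.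

Proof: `hi(Φ_r z i) = ⟪b(x_i(r)), Q_i(r)⟫ = ⟪b(x_i(0)), Q_i(r)⟫ + ⟪b(x_i(r)) − b(x_i(0)), Q_i(r)⟫`. The frozen part
is `Σ_i ⟪β_i, ∫Q_i⟫` (the inner product commutes with the integral), bounded by the landed weighted split S12′
`ClampedCurrentsDockHiSplitW.stub_hiHeatFluxSplitW` (`β_i = b(x_i(0))`, `‖β_i‖ ≤ Bb`, `R_i(r) = R(x_i(r), ‖W_i(r)‖²)`,
`C = C_R`). The drift part is bounded pointwise: `‖Q_i(r)‖ ≤ C_R ‖W_i(r)‖³` and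
`‖b(x_i(r)) − b(x_i(0))‖ ≤ min(2Bb, Lb dist(x_i(r), x_i(0))) ≤ min(2Bb, Lb ∫₀ʷ‖v_i‖)` (torus displacement ≤ path
length along a good orbit, `HardSphereFlow.euclidDist_flow_le_integral_norm_vel_of_mem_Icc`). All integrands are
continuous one-body functionals read along a good orbit, hence interval integrable (measurable in time, bounded by
compactness of the torus and conservation of energy).
-/

noncomputable section

namespace Summit.AtomisticToContinuum.HydrodynamicLimit.Theorems.ClampedCurrentsDockCubicPathwise

open scoped BigOperators ENNReal Classical Interval
open MeasureTheory Filter Set Topology InformationTheory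
open Literature.MathematicalPhysics.KineticTheory Literature.Analysis.FluidPDE Literature.Analysis.FunctionSpaces
open Summit.AtomisticToContinuum.HydrodynamicLimit.Theses.OneFlightGossipEngine
open Summit.AtomisticToContinuum.HydrodynamicLimit.Theorems

/-! ## The statement (verbatim from the line skeleton) -/

/-- registered stub signature QC-a of line IdeatorTwoSketch, crux ClampedCurrentsDock — route-internal, not a cited fact -/
def CubicChannelPathwise : Prop :=
  ∀ (σ : ℝ) (N : ℕ) (Φ : HardSphereFlow (Torus.geometry (Fin 3)) (hsDiameter σ N) (N + 1))
    (θ₀ : T3 → ℝ) (u₀ b : T3 → V3) (G : T3 × ℝ → ℝ) (Kstar C_G Bb Lb U θM η w : ℝ),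
    0 < σ → σ < 1 / 2 → 0 < Kstar → 0 ≤ C_G → 0 ≤ Bb → 0 ≤ Lb → 0 ≤ U → 0 ≤ θM → 0 < η → 0 ≤ w →
    Continuous θ₀ → Continuous u₀ → Continuous b → Continuous G → (∀ x, 0 < θ₀ x) → (∀ x, θ₀ x ≤ θM) →
    (∀ x, ‖u₀ x‖ ≤ U) → (∀ x, ‖b x‖ ≤ Bb) → (∀ x y : T3, ‖b x - b y‖ ≤ Lb * Torus.euclidDist x y) →
    (∀ y : T3 × ℝ, 0 ≤ y.2 → |G y| ≤ C_G) → (∀ (x : T3) (s' : ℝ), s' ≤ Kstar ^ 2 → G (x, s') = s' - 5 * θ₀ x) →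
    ∀ z ∈ Φ.good,
      (let W := fun (i : Fin (N + 1)) (r : ℝ) => (Φ.flow r z i).2 - u₀ (Φ.flow r z i).1
       let R := fun (x : T3) (s' : ℝ) => s' - 5 * θ₀ x - G (x, s')
       let hi := fun (y : T3 × V3) =>
         (∑ k : Fin 3, b y.1 k * (y.2 - u₀ y.1) k) * R y.1 (‖y.2 - u₀ y.1‖ ^ 2)
       let C_R : ℝ := 1 + (5 * θM + C_G) / Kstar ^ 2
       let Q := fun (i : Fin (N + 1)) (r : ℝ) => R (Φ.flow r z i).1 (‖W i r‖ ^ 2) • W i r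
       |∫ r in (0 : ℝ)..w, ∑ i : Fin (N + 1), hi (Φ.flow r z i)| ≤
         Bb * (η * (∑ i, ∫ r in (0 : ℝ)..w, ‖W i r‖ ^ 3) +
           C_R * ∑ i, (if η * ∫ r in (0 : ℝ)..w, ‖W i r‖ ^ 3 < ‖∫ r in (0 : ℝ)..w, Q i r‖ then
             ∫ r in (0 : ℝ)..w, (if Kstar < ‖W i r‖ then ‖W i r‖ ^ 3 else 0) else 0)) +
         C_R * ∑ i, min (2 * Bb) (Lb * ∫ r in (0 : ℝ)..w, ‖(Φ.flow r z i).2‖) * (∫ r in (0 : ℝ)..w, ‖W i r‖ ^ 3))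

/-! ## Toolkit: coordinates of the inner product, integrability along a good orbit -/

variable {ε : ℝ} {M : ℕ}

/-- The real inner product on `ℝ³` in coordinates: `⟪a, v⟫ = ∑ₖ aₖ vₖ`. [folklore] -/
theorem real_inner_eq_sum_mul (a v : V3) : inner ℝ a v = ∑ k, a k * v k := by
  rw [PiLp.inner_apply]
  exact Finset.sum_congr rfl fun j _ => by rw [RCLike.inner_apply, conj_trivial, mul_comm]

/-- The inner product with a fixed vector commutes with the interval integral. [folklore] -/
theorem integral_inner_eq (v : V3) {f : ℝ → V3} {a c : ℝ} (hf : IntervalIntegrable f volume a c) :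
    ∫ r in a..c, inner ℝ v (f r) = inner ℝ v (∫ r in a..c, f r) := by
  have h := (innerSL ℝ v).intervalIntegral_comp_comm hf
  simpa only [innerSL_apply_apply] using h

/-- A continuous one-body functional read along a good orbit, `r ↦ F(x_i(r), v_i(r))`, is interval integrable on every
bounded interval (measurable in time; bounded, the position ranging in the compact torus and the velocity in the
energy ball). [folklore] -/
theorem intervalIntegrable_orbit {E : Type*} [NormedAddCommGroup E] [MeasurableSpace E] [BorelSpace E]
    [SecondCountableTopology E]
    (Φ : HardSphereFlow (Torus.geometry (Fin 3)) ε M) {z : Config M (Fin 3) T3} (hz : z ∈ Φ.good)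
    {F : T3 × V3 → E} (hF : Continuous F) (i : Fin M) (a c : ℝ) :
    IntervalIntegrable (fun r => F (Φ.flow r z i)) volume a c := by
  -- adapted from `ClampedCurrentsDockCollisionalIdPrelim.intervalIntegrable_sum_orbit`
  obtain ⟨C, hC⟩ := (isCompact_univ.prod (isCompact_closedBall (0 : V3) (Real.sqrt (2 * configEnergy z))))
    |>.exists_bound_of_continuousOn hF.continuousOn
  have hmeas : Measurable fun r => F (Φ.flow r z i) :=
    hF.measurable.comp ((measurable_pi_apply i).comp (Φ.isTrajectory z hz).measurable_torus)
  have hbd : ∀ r, ‖F (Φ.flow r z i)‖ ≤ C := fun r =>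
    hC _ (Set.mem_prod.2 ⟨mem_univ _, mem_closedBall_zero_iff.2 (Φ.norm_vel_flow_le hz r i)⟩)
  exact (IntegrableOn.of_bound isCompact_uIcc.measure_lt_top hmeas.aestronglyMeasurable _
    (ae_of_all _ hbd)).intervalIntegrable

/-- Pointwise finite sums of interval integrable functions are interval integrable. [folklore] -/
theorem intervalIntegrable_fun_sum {E : Type*} [NormedAddCommGroup E] {ι : Type*} (s : Finset ι)
    {f : ι → ℝ → E} {a c : ℝ} (h : ∀ i ∈ s, IntervalIntegrable (f i) volume a c) :
    IntervalIntegrable (fun r => ∑ i ∈ s, f i r) volume a c := by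
  have hfun : (fun r => ∑ i ∈ s, f i r) = ∑ i ∈ s, f i := by
    funext r
    simp [Finset.sum_apply]
  rw [hfun]
  exact IntervalIntegrable.sum s h

/-! ## The radial remainder -/

/-- **The radial remainder `R(x, s′) = s′ − 5θ₀(x) − G(x, s′)`**: zero for `s′ ≤ K⋆²` (agreement clause of the
cut-off), and `|R(x, s′)| ≤ (1 + (5θM + C_G)/K⋆²) s′` for every `s′ ≥ 0` (boundedness clause, `0 < θ₀ ≤ θM`).
[folklore] -/
theorem abs_radialRemainder_le {θ₀ : T3 → ℝ} {G : T3 × ℝ → ℝ} {Kstar C_G θM : ℝ} (hK : 0 < Kstar)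
    (hCG : 0 ≤ C_G) (hθpos : ∀ x, 0 < θ₀ x) (hθle : ∀ x, θ₀ x ≤ θM)
    (hGbd : ∀ y : T3 × ℝ, 0 ≤ y.2 → |G y| ≤ C_G)
    (hGagree : ∀ (x : T3) (s' : ℝ), s' ≤ Kstar ^ 2 → G (x, s') = s' - 5 * θ₀ x)
    (x : T3) {s' : ℝ} (hs' : 0 ≤ s') :
    |s' - 5 * θ₀ x - G (x, s')| ≤ (1 + (5 * θM + C_G) / Kstar ^ 2) * s' := by
  have hK2 : 0 < Kstar ^ 2 := by positivity
  have hθM : 0 ≤ θM := (hθpos x).le.trans (hθle x)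
  rcases le_or_gt s' (Kstar ^ 2) with hle | hlt
  · rw [hGagree x s' hle, sub_self, abs_zero]
    have : 0 ≤ (5 * θM + C_G) / Kstar ^ 2 := by positivity
    positivity
  · have h1 : |s' - 5 * θ₀ x - G (x, s')| ≤ s' + 5 * θM + C_G := by
      have hG := hGbd (x, s') hs'
      have hθ := hθle x
      have hθ0 := (hθpos x).le
      rw [abs_le] at hG ⊢
      constructor <;> nlinarith [hG.1, hG.2]
    have h2 : 5 * θM + C_G ≤ (5 * θM + C_G) / Kstar ^ 2 * s' := by
      rw [div_mul_eq_mul_div, le_div_iff₀ hK2]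
      exact mul_le_mul_of_nonneg_left hlt.le (by positivity)
    calc |s' - 5 * θ₀ x - G (x, s')| ≤ s' + 5 * θM + C_G := h1
      _ ≤ s' + (5 * θM + C_G) / Kstar ^ 2 * s' := by linarith
      _ = (1 + (5 * θM + C_G) / Kstar ^ 2) * s' := by ring

/-- The weighted signal is dominated by the cube: `|t| ≤ C ‖W‖²` gives `‖t • W‖ ≤ C ‖W‖³`. [folklore] -/
theorem norm_smul_le_cube {C t : ℝ} {Wv : V3} (ht : |t| ≤ C * ‖Wv‖ ^ 2) : ‖t • Wv‖ ≤ C * ‖Wv‖ ^ 3 := by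
  rw [norm_smul, Real.norm_eq_abs]
  calc |t| * ‖Wv‖ ≤ C * ‖Wv‖ ^ 2 * ‖Wv‖ := mul_le_mul_of_nonneg_right ht (norm_nonneg _)
    _ = C * ‖Wv‖ ^ 3 := by ring

/-! ## The stub -/

/-- **STUB QC-a `stub_cubicChannelPathwise`** of line `IdeatorTwoSketch` (crux `ClampedCurrentsDock`, stmt-14680): the
frozen part by the landed weighted split S12′ after commuting `⟪β_i, ·⟫` with the window integral, the drift part
pointwise by `‖Q_i‖ ≤ C_R‖W_i‖³` and the path-length bound on the torus displacement. [folklore] -/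
theorem stub_cubicChannelPathwise : CubicChannelPathwise := by
  intro σ N Φ θ₀ u₀ b G Kstar C_G Bb Lb U θM η w _hσ _hσ' hK hCG hBb hLb _hU _hθM hη hw hθc huc hbc hGc hθpos hθle
    _huU hbB hbLip hGbd hGagree z hz W R hi C_R Q
  -- constants and the radial remainder
  have hCR : 0 ≤ C_R := by
    have hθM : 0 ≤ θM := (hθpos 0).le.trans (hθle 0)
    show 0 ≤ 1 + (5 * θM + C_G) / Kstar ^ 2
    positivity
  have hRzero : ∀ (x : T3) (s' : ℝ), s' ≤ Kstar ^ 2 → R x s' = 0 := fun x s' hs' => by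
    show s' - 5 * θ₀ x - G (x, s') = 0
    rw [hGagree x s' hs', sub_self]
  have hRle : ∀ (x : T3) (s' : ℝ), 0 ≤ s' → |R x s'| ≤ C_R * s' := fun x s' hs' =>
    abs_radialRemainder_le hK hCG hθpos hθle hGbd hGagree x hs'
  -- the frozen vectors, the scalar weights, the drift
  set β : Fin (N + 1) → V3 := fun i => b (Φ.flow 0 z i).1 with hβ
  set Rr : Fin (N + 1) → ℝ → ℝ := fun i r => R (Φ.flow r z i).1 (‖W i r‖ ^ 2) with hRr
  set m : Fin (N + 1) → ℝ := fun i => min (2 * Bb) (Lb * ∫ r in (0 : ℝ)..w, ‖(Φ.flow r z i).2‖) with hm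
  have hQdef : ∀ i r, Q i r = Rr i r • W i r := fun i r => rfl
  -- pointwise facts
  have hzero : ∀ i r, ‖W i r‖ ≤ Kstar → Rr i r = 0 := fun i r h =>
    hRzero _ _ (pow_le_pow_left₀ (norm_nonneg _) h 2)
  have hdom : ∀ i r, |Rr i r| ≤ C_R * ‖W i r‖ ^ 2 := fun i r => hRle _ _ (sq_nonneg _)
  have hQle : ∀ i r, ‖Q i r‖ ≤ C_R * ‖W i r‖ ^ 3 := fun i r => norm_smul_le_cube (hdom i r)
  have hβle : ∀ i, ‖β i‖ ≤ Bb := fun i => hbB _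
  have hdrift : ∀ i, ∀ r ∈ Icc (0 : ℝ) w, ‖b (Φ.flow r z i).1 - β i‖ ≤ m i := by
    intro i r hr
    refine le_min ?_ ?_
    · calc ‖b (Φ.flow r z i).1 - β i‖ ≤ ‖b (Φ.flow r z i).1‖ + ‖β i‖ := norm_sub_le _ _
        _ ≤ Bb + Bb := add_le_add (hbB _) (hbB _)
        _ = 2 * Bb := by ring
    · exact (hbLip _ _).trans (mul_le_mul_of_nonneg_left
        (Φ.euclidDist_flow_le_integral_norm_vel_of_mem_Icc hz i hr) hLb)
  have hm0 : ∀ i, 0 ≤ m i := fun i => (norm_nonneg _).trans (hdrift i 0 ⟨le_rfl, hw⟩)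
  -- the heat-flux remainder along the orbit is the inner product of `b(x_i(r))` with the signal
  have hhi : ∀ i r, hi (Φ.flow r z i) = inner ℝ (b (Φ.flow r z i).1) (Q i r) := by
    intro i r
    rw [hQdef, real_inner_smul_right, real_inner_eq_sum_mul, mul_comm]
  have hsplit : ∀ i r, hi (Φ.flow r z i) =
      inner ℝ (β i) (Q i r) + inner ℝ (b (Φ.flow r z i).1 - β i) (Q i r) := by
    intro i r
    rw [hhi, inner_sub_left]
    ring
  -- measurability and integrability along the good orbit
  have hmeas : ∀ i, Measurable fun r => Φ.flow r z i := fun i =>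
    (measurable_pi_apply i).comp (Φ.isTrajectory z hz).measurable_torus
  have hWm : ∀ i, Measurable (W i) := fun i =>
    (hmeas i).snd.sub (huc.measurable.comp (hmeas i).fst)
  have hRc : Continuous fun y : T3 × V3 => R y.1 (‖y.2 - u₀ y.1‖ ^ 2) := by
    show Continuous fun y : T3 × V3 => ‖y.2 - u₀ y.1‖ ^ 2 - 5 * θ₀ y.1 - G (y.1, ‖y.2 - u₀ y.1‖ ^ 2)
    fun_prop
  have hRm : ∀ i, Measurable (Rr i) := fun i => hRc.measurable.comp (hmeas i)
  have hqc : Continuous fun y : T3 × V3 => R y.1 (‖y.2 - u₀ y.1‖ ^ 2) • (y.2 - u₀ y.1) :=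
    hRc.smul (by fun_prop)
  have hQint : ∀ i, IntervalIntegrable (Q i) volume 0 w := fun i =>
    intervalIntegrable_orbit Φ hz hqc i 0 w
  have hW3int : ∀ i, IntervalIntegrable (fun r => ‖W i r‖ ^ 3) volume 0 w := fun i =>
    intervalIntegrable_orbit Φ hz (F := fun y : T3 × V3 => ‖y.2 - u₀ y.1‖ ^ 3) (by fun_prop) i 0 w
  have hfrozint : ∀ i, IntervalIntegrable (fun r => inner ℝ (β i) (Q i r)) volume 0 w := fun i =>
    intervalIntegrable_orbit Φ hz
      (F := fun y : T3 × V3 => inner ℝ (β i) (R y.1 (‖y.2 - u₀ y.1‖ ^ 2) • (y.2 - u₀ y.1)))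
      (continuous_const.inner hqc) i 0 w
  have hdriftint : ∀ i, IntervalIntegrable (fun r => inner ℝ (b (Φ.flow r z i).1 - β i) (Q i r)) volume 0 w :=
    fun i => intervalIntegrable_orbit Φ hz
      (F := fun y : T3 × V3 => inner ℝ (b y.1 - β i) (R y.1 (‖y.2 - u₀ y.1‖ ^ 2) • (y.2 - u₀ y.1)))
      ((by fun_prop : Continuous fun y : T3 × V3 => b y.1 - β i).inner hqc) i 0 w
  -- FIRST PART: the frozen vectors, S12′
  have hS := ClampedCurrentsDockHiSplitW.stub_hiHeatFluxSplitW (N + 1) 0 w Kstar η Bb C_R W Rr β hw hK hη hCR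
    hWm hRm (by simpa only [zero_add] using hW3int) hzero hdom hβle
  simp only [zero_add] at hS
  have hfrozen : |∑ i, inner ℝ (β i) (∫ r in (0 : ℝ)..w, Q i r)| ≤
      Bb * (η * (∑ i, ∫ r in (0 : ℝ)..w, ‖W i r‖ ^ 3) +
        C_R * ∑ i, (if η * ∫ r in (0 : ℝ)..w, ‖W i r‖ ^ 3 < ‖∫ r in (0 : ℝ)..w, Q i r‖ then
          ∫ r in (0 : ℝ)..w, (if Kstar < ‖W i r‖ then ‖W i r‖ ^ 3 else 0) else 0)) := hS
  -- SECOND PART: the drift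
  have hgint : IntervalIntegrable (fun r => ∑ i, m i * (C_R * ‖W i r‖ ^ 3)) volume 0 w :=
    intervalIntegrable_fun_sum _ fun i _ => ((hW3int i).const_mul C_R).const_mul (m i)
  have hdriftle : |∫ r in (0 : ℝ)..w, ∑ i, inner ℝ (b (Φ.flow r z i).1 - β i) (Q i r)| ≤
      C_R * ∑ i, m i * (∫ r in (0 : ℝ)..w, ‖W i r‖ ^ 3) := by
    have h1 : |∫ r in (0 : ℝ)..w, ∑ i, inner ℝ (b (Φ.flow r z i).1 - β i) (Q i r)| ≤
        ∫ r in (0 : ℝ)..w, ∑ i, m i * (C_R * ‖W i r‖ ^ 3) := by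
      rw [← Real.norm_eq_abs]
      refine intervalIntegral.norm_integral_le_of_norm_le hw (ae_of_all _ fun r hr => ?_) hgint
      refine (norm_sum_le _ _).trans (Finset.sum_le_sum fun i _ => ?_)
      calc ‖inner ℝ (b (Φ.flow r z i).1 - β i) (Q i r)‖ ≤ ‖b (Φ.flow r z i).1 - β i‖ * ‖Q i r‖ :=
            norm_inner_le_norm _ _
        _ ≤ m i * (C_R * ‖W i r‖ ^ 3) :=
            mul_le_mul (hdrift i r ⟨hr.1.le, hr.2⟩) (hQle i r) (norm_nonneg _) (hm0 i)
    have h2 : ∫ r in (0 : ℝ)..w, ∑ i, m i * (C_R * ‖W i r‖ ^ 3) =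
        C_R * ∑ i, m i * (∫ r in (0 : ℝ)..w, ‖W i r‖ ^ 3) := by
      rw [intervalIntegral.integral_finsetSum fun i _ => ((hW3int i).const_mul C_R).const_mul (m i),
        Finset.mul_sum]
      refine Finset.sum_congr rfl fun i _ => ?_
      rw [intervalIntegral.integral_const_mul, intervalIntegral.integral_const_mul]
      ring
    exact h1.trans_eq h2
  -- the decomposition of the window integral
  have hdecomp : ∫ r in (0 : ℝ)..w, ∑ i, hi (Φ.flow r z i) =
      ∑ i, inner ℝ (β i) (∫ r in (0 : ℝ)..w, Q i r) +
        ∫ r in (0 : ℝ)..w, ∑ i, inner ℝ (b (Φ.flow r z i).1 - β i) (Q i r) := by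
    have h1 : ∫ r in (0 : ℝ)..w, ∑ i, hi (Φ.flow r z i) =
        ∫ r in (0 : ℝ)..w, ((∑ i, inner ℝ (β i) (Q i r)) + ∑ i, inner ℝ (b (Φ.flow r z i).1 - β i) (Q i r)) := by
      refine intervalIntegral.integral_congr fun r _ => ?_
      simp only [hsplit, Finset.sum_add_distrib]
    rw [h1, intervalIntegral.integral_add (intervalIntegrable_fun_sum _ fun i _ => hfrozint i)
      (intervalIntegrable_fun_sum _ fun i _ => hdriftint i),
      intervalIntegral.integral_finsetSum fun i _ => hfrozint i]
    congr 1
    exact Finset.sum_congr rfl fun i _ => integral_inner_eq (β i) (hQint i)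
  -- conclusion
  rw [hdecomp]
  exact (abs_add_le _ _).trans (add_le_add hfrozen hdriftle)

end Summit.AtomisticToContinuum.HydrodynamicLimit.Theorems.ClampedCurrentsDockCubicPathwise

end
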